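import Literature.NumberTheory.Rogawski1990.LocalStableClassesNonsplitRankTwo      -- ★ B-p04: the rank-two class set (two classes)
import Literature.NumberTheory.Rogawski1990.LocalNormFibreNonsplit                 -- ★ `IsLocalStablyConjH.snd_eq`
import Literature.NumberTheory.Rogawski1990.UnitStableOrbitalIntegralIrredOneClass          -- ★ `adelicForm_antidiagTwo_local_hermitian`, `isUnit_det_adelicForm_antidiagTwo_local`
import HarnessLib

/-!
# The `H_v`-stable class of a split-torus element of `H_v = U(Φ₂)(L⁺_v) × U(Φ₁)(L⁺_v)` is EXACTLY TWO `H_v`-classes — part (i) of the junction binder (J2a) `halt`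
# (Rogawski 1990 §3.5 Prop. 3.5.2 (c), §3.6; Flicker 1998 §6 p. 95)

Topic `NumberTheory/Rogawski1990`; namespace `Literature.NumberTheory.Rogawski1990`.  **Theorems only** (no `def`, no instance, no notation, no named fact, no
`sorry`); imports = tree.  Brick (J2a)(i) of the floor-2 line «N6nsGerm», stub `stub_N6nsS2` (LEAD F0P3a-plan T8-122 (1), ruling T8-124 (q9): «cut (i) stand-alone,
θ-free»): the binder `halt` of ★ `exists_nhds_finsum_delta_dock_eq_locallyConstant_of_rankOneUnstable` (B-p08) asks, near the torus base, that the `H_v`-stable class of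
`τ t` be `{⟦τ t⟧, d′}` with `d′ ≠ ⟦τ t⟧` AND that `Δ‴_v(↑t, θ ·)` alternate in sign on the two classes.  THIS FILE proves the first half for every `h = (g, u) ∈ H_v` whose
`U(Φ₂)`-part has a split eigenframe over `E_v` (the junction's (J1) frame `(t₀, P, dg)`): ★ B-p04's rank-two class set (`exists_isStablyConj_not_isConj_forall_isConj_or_rankTwo`:
sign vectors `(0,0), (1,1)`) on the `U(Φ₂)`-factor, equality of the `U(Φ₁)`-components of stably conjugate elements (★ `IsLocalStablyConjH.snd_eq`), and conjugacy in a product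
being componentwise.  The second half (the SIGN) is dock-dependent — see the census `F0/P3/F0P3-p02/g11/CENSUS-J2a-KappaAlternation.F0P3p02g11.md`: for docks
`θ = Int(M) ∘ ι_v` the sign does NOT alternate (★ `finKappaAt_conj_eq_iff_normTest`: the `u_t`-line is fixed); it alternates on the two `G′_ε`-classes of Rogawski 8.2.1 (c).

* **`exists_isLocalStablyConjH_not_isConj_forall_isConj_or`** (element form) · **`exists_setOf_isLocalStablyConjH_out_eq_pair`** (the binder's set form:
  `∃ d′ ≠ ⟦h⟧, {d | IsLocalStablyConjH L v h (out d)} = {⟦h⟧, d′}`).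

## References
* J. Rogawski, *Automorphic Representations of Unitary Groups in Three Variables*, Ann. of Math. Stud. 123 (1990), §3.1 p. 19, §3.5 Prop. 3.5.2 (c) p. 29, §3.6 p. 31,
  §8.2 Prop. 8.2.1 (c) pp. 113–115 [Rogawski1990].
* Y. Z. Flicker, *Elementary proof of the fundamental lemma for a unitary group*, Canad. J. Math. 50 (1998), §6 p. 95 [Flicker1998UnitaryFL].
* C. P. Mok, *Endoscopic classification of representations of quasi-split unitary groups*, Mem. AMS 235 (2015), §1 p. 5 [Mok2014].
-/

set_option autoImplicit false

noncomputable section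

open NumberField IsDedekindDomain Matrix
open scoped MatrixGroups

namespace Literature.NumberTheory.Rogawski1990

open Literature.NumberTheory.Automorphic Literature.NumberTheory.Automorphic.UnitaryGroup
open Literature.AlgebraicGeometry.ShimuraVarieties (unitaryGroup)

/-- Conjugacy in a product of monoids is componentwise. [folklore] -/
private theorem isConj_prod_mk_iff_components {A B : Type*} [Group A] [Group B] {a a' : A} {b b' : B} :
    IsConj (a, b) (a', b') ↔ IsConj a a' ∧ IsConj b b' := by
  constructor
  · intro h
    exact ⟨MonoidHom.map_isConj (MonoidHom.fst A B) h, MonoidHom.map_isConj (MonoidHom.snd A B) h⟩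
  · rintro ⟨ha, hb⟩
    obtain ⟨c, hc⟩ := isConj_iff.1 ha
    obtain ⟨d, hd⟩ := isConj_iff.1 hb
    exact isConj_iff.2 ⟨(c, d), by rw [Prod.mk_mul_mk, Prod.inv_mk, Prod.mk_mul_mk, hc, hd]⟩

section HTwo

variable (L : Type) [Field L] [NumberField L] [IsCMField L] {v : HeightOneSpectrum (𝓞 ↥(maximalRealSubfield L))}

/-- **PART (i) OF (J2a): THE `H_v`-STABLE CLASS OF A SPLIT-TORUS ELEMENT IS EXACTLY TWO `H_v`-CLASSES.**  At a non-split place `v`, let `h = (g, u) ∈ H_v = U(Φ₂)(L⁺_v) × U(Φ₁)(L⁺_v)`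
with `g` of split torus type: an eigenframe `g P = P diag(dg)` over `E_v` with `dg` injective and norm one (the frame `(t₀, P, dg)` of the junction's (J1)).  Then there is
`h′ = (g′, u) ∈ H_v`, `g′ = x g x⁻¹` for the stable conjugator `x` FAILING the norm test (★ `exists_isStablyConj_not_isConj_forall_isConj_or_rankTwo`: sign vectors
`(0,0), (1,1)`), with `h′` stably conjugate (★ `IsLocalStablyConjH`) and NOT conjugate to `h` in `H_v`, and every `k ∈ H_v` stably conjugate to `h` is `H_v`-conjugate to `h` or to
`h′` — the `U(Φ₁)`-components of stably conjugate elements are EQUAL (★ `IsLocalStablyConjH.snd_eq`), conjugacy in the product is componentwise.  (Part (ii) of (J2a), the sign of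
`Δ‴_v` on the two classes, depends on the dock `θ` and is NOT stated here.) [cite: Rogawski1990, §3.5 Prop. 3.5.2 (c) p. 29; §3.6 p. 31; §3.1 p. 19] [cite: Flicker1998UnitaryFL, §6 p. 95] -/
theorem exists_isLocalStablyConjH_not_isConj_forall_isConj_or (w : PlacesOver L v) (hw : IsCMField.complexConj L • w.1 = w.1)
    {h : (cmDatum L 2 (Matrix.of fun i j : Fin 2 => if i.val + j.val + 1 = 2 then (1 : L) else 0)).Local v ×
      (cmDatum L 1 (Matrix.of fun i j : Fin 1 => if i.val + j.val + 1 = 1 then (1 : L) else 0)).Local v}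
    {P : GL (Fin 2) (LocalRing L v)} {dg : Fin 2 → LocalRing L v}
    (hP : (h.1.val.val : Matrix (Fin 2) (Fin 2) (LocalRing L v)) * P.val = P.val * diagonal dg) (hdg : Function.Injective dg)
    (hdg1 : ∀ i, conjLocal L (IsCMField.complexConj L) v (dg i) * dg i = 1) :
    ∃ h' : (cmDatum L 2 (Matrix.of fun i j : Fin 2 => if i.val + j.val + 1 = 2 then (1 : L) else 0)).Local v ×
        (cmDatum L 1 (Matrix.of fun i j : Fin 1 => if i.val + j.val + 1 = 1 then (1 : L) else 0)).Local v,
      IsLocalStablyConjH L v h h' ∧ ¬ IsConj h h' ∧ ∀ k, IsLocalStablyConjH L v h k → IsConj h k ∨ IsConj h' k := by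
  classical
  obtain ⟨αg, hα0, hcα, -⟩ := cmQuadraticGenerator_spec L
  have hH := adelicForm_antidiagTwo_local_hermitian L v
  have hHd := isUnit_det_adelicForm_antidiagTwo_local L v
  obtain ⟨g, hg, -, hst, hnc, hall⟩ := exists_isStablyConj_not_isConj_forall_isConj_or_rankTwo L v (IsCMField.complexConj L) hcα hα0 w hw hH hHd
    h.1.2 hP hdg hdg1
  refine ⟨(⟨g * h.1.val * g⁻¹, hg⟩, h.2), ⟨hst, IsStablyConj.refl _⟩, fun hc => hnc (isConj_prod_mk_iff_components.1 hc).1, fun k hk => ?_⟩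
  have h2 : h.2 = k.2 := hk.snd_eq
  rcases hall ⟨k.1.val, k.1.2⟩ hk.1 with h1 | h1
  · exact Or.inl (isConj_prod_mk_iff_components.2 ⟨h1, by rw [h2]⟩)
  · exact Or.inr (isConj_prod_mk_iff_components.2 ⟨h1, by rw [h2]⟩)

/-- **PART (i) OF (J2a) IN THE BINDER'S SET FORM** (`halt`'s first two conjuncts, ★ p842056 :99): `∃ d′ ≠ ⟦h⟧` with
`{d | IsLocalStablyConjH L v h (out d)} = {⟦h⟧, d′}`. [cite: Rogawski1990, §3.5 Prop. 3.5.2 (c) p. 29; §3.6 p. 31] [cite: Flicker1998UnitaryFL, §6 p. 95] -/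
theorem exists_setOf_isLocalStablyConjH_out_eq_pair (w : PlacesOver L v) (hw : IsCMField.complexConj L • w.1 = w.1)
    {h : (cmDatum L 2 (Matrix.of fun i j : Fin 2 => if i.val + j.val + 1 = 2 then (1 : L) else 0)).Local v ×
      (cmDatum L 1 (Matrix.of fun i j : Fin 1 => if i.val + j.val + 1 = 1 then (1 : L) else 0)).Local v}
    {P : GL (Fin 2) (LocalRing L v)} {dg : Fin 2 → LocalRing L v}
    (hP : (h.1.val.val : Matrix (Fin 2) (Fin 2) (LocalRing L v)) * P.val = P.val * diagonal dg) (hdg : Function.Injective dg)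
    (hdg1 : ∀ i, conjLocal L (IsCMField.complexConj L) v (dg i) * dg i = 1) :
    ∃ d' : ConjClasses ((cmDatum L 2 (Matrix.of fun i j : Fin 2 => if i.val + j.val + 1 = 2 then (1 : L) else 0)).Local v ×
        (cmDatum L 1 (Matrix.of fun i j : Fin 1 => if i.val + j.val + 1 = 1 then (1 : L) else 0)).Local v),
      d' ≠ ConjClasses.mk h ∧ {d | IsLocalStablyConjH L v h (Quotient.out d)} = {ConjClasses.mk h, d'} := by
  classical
  obtain ⟨h', hst, hnc, hall⟩ := exists_isLocalStablyConjH_not_isConj_forall_isConj_or L w hw hP hdg hdg1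
  have hout : ∀ c : ConjClasses ((cmDatum L 2 (Matrix.of fun i j : Fin 2 => if i.val + j.val + 1 = 2 then (1 : L) else 0)).Local v ×
      (cmDatum L 1 (Matrix.of fun i j : Fin 1 => if i.val + j.val + 1 = 1 then (1 : L) else 0)).Local v), ConjClasses.mk (Quotient.out c) = c := fun c => by
    rw [← ConjClasses.quotient_mk_eq_mk, Quotient.out_eq]
  -- conjugate elements are stably conjugate (componentwise)
  have hstc : ∀ {a b : (cmDatum L 2 (Matrix.of fun i j : Fin 2 => if i.val + j.val + 1 = 2 then (1 : L) else 0)).Local v ×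
      (cmDatum L 1 (Matrix.of fun i j : Fin 1 => if i.val + j.val + 1 = 1 then (1 : L) else 0)).Local v}, IsConj a b → IsLocalStablyConjH L v a b := by
    intro a b hab
    obtain ⟨h1, h2⟩ := isConj_prod_mk_iff_components.1 (show IsConj (a.1, a.2) (b.1, b.2) from hab)
    exact ⟨isStablyConj_of_isConj h1, isStablyConj_of_isConj h2⟩
  refine ⟨ConjClasses.mk h', fun he => hnc (ConjClasses.mk_eq_mk_iff_isConj.1 he.symm), Set.ext fun d => ⟨fun hd => ?_, fun hd => ?_⟩⟩
  · rcases hall _ hd with h1 | h1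
    · exact Or.inl ((hout d).symm.trans (ConjClasses.mk_eq_mk_iff_isConj.2 h1.symm))
    · exact Or.inr ((hout d).symm.trans (ConjClasses.mk_eq_mk_iff_isConj.2 h1.symm))
  · rcases hd with rfl | rfl
    · exact hstc (ConjClasses.mk_eq_mk_iff_isConj.1 (hout (ConjClasses.mk h)).symm)
    · exact hst.trans (hstc (ConjClasses.mk_eq_mk_iff_isConj.1 (hout (ConjClasses.mk h')).symm))

end HTwo

end Literature.NumberTheory.Rogawski1990
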